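import Mathlib
import Summits.Ventures.HodgeRepro.Tier4.Common.CocompactDomain
import Summits.Ventures.HodgeRepro.Tier4.Common.ConcretePD

/-!
# Tier4/Common/ConcreteCocompact — `P_T4` from (P) for the concrete witness on the CANONICAL domain of a cocompact
level: the assembly on t4-L4-p1's `CocompactDomain`

Blind re-derivation cell `pub-hodge-repro`, Tier 4 (README §9–§10), seat t4-typer-1 (gen 1).  Target tree path
`lean/Summits/Ventures/HodgeRepro/Tier4/Common/ConcreteCocompact.lean`.  Imports `CocompactDomain` (t4-L4-p1, p667356,
20:55Z: the transversal `dom d Γ'` IS a fundamental domain — `isDomain_dom` — and lies in `{nsq ≤ r}` whenever a set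
inside `{nsq ≤ r}` meets every orbit — `nsq_dom_le`; `exists_domain_nsq_le` / `exists_domain_closure_subset` from the
printed cocompactness) and `ConcretePD` (typer-1 g1: `residual_of_domain`, `conclusion_of_concrete_P_domain`).  The
observation that the key-least point of an orbit is `nsq`-least, hence that (K) makes the canonical domain relatively
compact, is t4-L4-p1's (S12601); nothing of it is restated here — this file only ASSEMBLES the consequence for the
concrete witness, on the NAMED domain `dom d Γ'` rather than an existential one.

WHAT IS PROVED.  `TargetData.IsCocompact Γ'` (the `∃ K compact ⊆ 𝔹²` meeting every orbit shape — the conclusion of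
lit-3's printed `BorelHarishChandra1962_Thm11_8_cocompact_hdef`), `isCocompact_of_BHC`, `exists_r_nsq_le_dom` /
`closure_dom_subset_ball` (relative compactness of `dom d Γ'` under `IsCocompact`, via L4-p1's `nsq_dom_le`),
**`residual_of_cocompact hΓ' hcc : d.ConcreteResidual Γ' (dom d Γ')`** (the whole residual bundle (T0)–(T3) on the
canonical domain from cocompactness alone), `conclusion_of_concrete_P_cocompact`, **`P_T4_of_concrete_cocompact`**
(P_T4 from (P) for the concrete witness on `dom d Γ'` of a cocompact level) and **`P_T4_of_concrete_K`** (the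
cocompactness supplied by the printed Prop: the only hypothesis left is (P) for the concrete witness at level `Γ`
on `dom d d.Γ`).  Geometric side of (P): ONE printed input (Godement's cocompactness, lit-3 row 26) and a canonical
domain; the lines' residual is (P) for the concrete witness on it.

Nothing here says anything about the status of the Hodge conjecture for CM abelian varieties, which is NOT proved
(HC_CM is NOT proved by anyone in this repository).
-/

set_option autoImplicit false

noncomputable section

open Matrix MeasureTheory NumberField Set
open scoped ComplexConjugate ComplexOrder

namespace Summit.Ventures.HodgeRepro.Tier4

open Summit.Ventures.HodgeRepro.Tier4.Common

namespace TargetData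

variable {F E : Type} [Field F] [NumberField F] [IsGalois ℚ F] [IsCMField F]
  [Field E] [NumberField E] [IsGalois ℚ E] [IsCMField E] (d : TargetData F E)

/-- **Cocompactness of the ball action of a level**, in the shape of the printed input: some compact `K ⊆ 𝔹²` meets
every `Γ′`-orbit of the ball. -/
def IsCocompact (Γ' : Set (Matrix (Fin 3) (Fin 3) E)) : Prop :=
  ∃ K : Set (Fin 2 → ℂ), IsCompact K ∧ K ⊆ ball ∧ ∀ z ∈ ball, ∃ γ ∈ Γ', d.act γ z ∈ K

/-- The printed `Lit.BorelHarishChandra1962_Thm11_8_cocompact_hdef` of the datum's `(E, H, τ₀, C)` gives the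
cocompactness of every level (the datum supplies `hH`, `hani`, `hC`, `hdef`). -/
theorem isCocompact_of_BHC (hBHC : Lit.BorelHarishChandra1962_Thm11_8_cocompact_hdef E d.H d.τ₀ d.C)
    {Γ' : Set (Matrix (Fin 3) (Fin 3) E)} (hΓ' : d.IsLevel Γ') : d.IsCocompact Γ' :=
  hBHC d.hH d.hani d.hC d.hdef Γ' hΓ'.1

/-- **Under cocompactness the canonical domain is relatively compact**: `nsq ≤ r < 1` on `dom d Γ'`
(t4-L4-p1's `nsq_dom_le` with the compact `K` inside some `{nsq ≤ r}`, `r < 1`). -/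
theorem exists_r_nsq_le_dom {Γ' : Set (Matrix (Fin 3) (Fin 3) E)} (hcc : d.IsCocompact Γ') :
    ∃ r : ℝ, r < 1 ∧ ∀ z ∈ dom d Γ', nsq z ≤ r := by
  obtain ⟨K, hK, hKb, hmeet⟩ := hcc
  obtain ⟨r, hr, hKr⟩ := exists_cball_of_isCompact hK hKb
  exact ⟨r, hr, fun z hz => nsq_dom_le d hmeet (fun w hw => mem_cball.1 (hKr hw)) hz⟩

/-- The closure of the canonical domain lies in the ball, under cocompactness. -/
theorem closure_dom_subset_ball {Γ' : Set (Matrix (Fin 3) (Fin 3) E)} (hcc : d.IsCocompact Γ') :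
    closure (dom d Γ') ⊆ ball := by
  obtain ⟨r, hr, hD⟩ := d.exists_r_nsq_le_dom hcc
  exact closure_subset_ball_of_nsq_le hr hD

/-- **The residual bundle on the canonical domain from cocompactness alone**: (T0)–(T3) for `dom d Γ'`. -/
theorem residual_of_cocompact {Γ' : Set (Matrix (Fin 3) (Fin 3) E)} (hΓ' : d.IsLevel Γ') (hcc : d.IsCocompact Γ') :
    d.ConcreteResidual Γ' (dom d Γ') :=
  d.residual_of_domain hΓ' (isDomain_dom d hΓ') (d.closure_dom_subset_ball hcc)

/-- (P) for the concrete witness on the canonical domain of a cocompact level gives the conclusion of `P_T4`. -/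
theorem conclusion_of_concrete_P_cocompact {Γ' : Set (Matrix (Fin 3) (Fin 3) E)} (hΓ' : d.IsLevel Γ')
    (hcc : d.IsCocompact Γ')
    (hP : (d.concreteWitness hΓ' (isDomain_dom d hΓ').subset_ball (isDomain_dom d hΓ').measurableSet
      (d.residual_of_cocompact hΓ' hcc)).P) : d.conclusion :=
  d.conclusion_of_concrete_P hΓ' (isDomain_dom d hΓ') _ hP

end TargetData

/-- **`P_T4` from (P) for the concrete witness on the canonical domain of a cocompact level**: if every datum has a
level `Γ′` whose ball action is cocompact and (P) for the concrete witness on `dom d Γ'`, then `P_T4`. -/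
theorem P_T4_of_concrete_cocompact
    (h : ∀ (F E : Type) [Field F] [NumberField F] [IsGalois ℚ F] [IsCMField F]
      [Field E] [NumberField E] [IsGalois ℚ E] [IsCMField E] (d : TargetData F E),
      ∃ (Γ' : Set (Matrix (Fin 3) (Fin 3) E)) (hΓ' : d.IsLevel Γ') (hcc : d.IsCocompact Γ'),
        (d.concreteWitness hΓ' (isDomain_dom d hΓ').subset_ball (isDomain_dom d hΓ').measurableSet
          (d.residual_of_cocompact hΓ' hcc)).P) :
    P_T4 := by
  refine P_T4_of_forall fun F E _ _ _ _ _ _ _ _ d => ?_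
  obtain ⟨Γ', hΓ', hcc, hP⟩ := h F E d
  exact d.conclusion_of_concrete_P_cocompact hΓ' hcc hP

/-- **`P_T4` modulo the ONE printed input** — Godement's cocompactness in the `∃ K compact` shape (lit-3's
`…_Thm11_8_cocompact_hdef`, cite-only): if for every datum (P) holds for the concrete witness at the level `Γ` on the
canonical domain `dom d d.Γ`, built from the printed cocompactness alone, then `P_T4`. -/
theorem P_T4_of_concrete_K
    (hK : ∀ (E : Type) [Field E] [NumberField E] [IsGalois ℚ E] [IsCMField E] (H : Matrix (Fin 3) (Fin 3) E)
      (τ₀ : E →+* ℂ) (C : Matrix (Fin 3) (Fin 3) ℂ), Lit.BorelHarishChandra1962_Thm11_8_cocompact_hdef E H τ₀ C)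
    (h : ∀ (F E : Type) [Field F] [NumberField F] [IsGalois ℚ F] [IsCMField F]
      [Field E] [NumberField E] [IsGalois ℚ E] [IsCMField E] (d : TargetData F E)
      (hBHC : Lit.BorelHarishChandra1962_Thm11_8_cocompact_hdef E d.H d.τ₀ d.C),
      (d.concreteWitness d.isLevel_self (isDomain_dom d d.isLevel_self).subset_ball
        (isDomain_dom d d.isLevel_self).measurableSet
        (d.residual_of_cocompact d.isLevel_self (d.isCocompact_of_BHC hBHC d.isLevel_self))).P) :
    P_T4 := by
  refine P_T4_of_forall fun F E _ _ _ _ _ _ _ _ d => ?_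
  exact d.conclusion_of_concrete_P_cocompact d.isLevel_self (d.isCocompact_of_BHC (hK E d.H d.τ₀ d.C) d.isLevel_self)
    (h F E d (hK E d.H d.τ₀ d.C))

end Summit.Ventures.HodgeRepro.Tier4
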